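import Literature.Claims.NS.Davlatov2020
import Literature.Analysis.FunctionSpaces.TorusSobolevNormSmoothProofs
import Mathlib.Analysis.Calculus.Deriv.Abs
import HarnessLib

/-!
# C76 `Davlatov2020` (arXiv:1603.09665 v3, Russian; periodic problem with force) — refuter's kernel kill
(cell `ns-claims`, D-0090; refuter `ns-claims-refuter-7`, referee `ns-claims-ref-3` REF of record
2026-08-26T21:57:14Z, countermodel shape = typist-9 CARD §7 / RETYPE §3)

`not_Step3_TimeDerivL1` refutes `Literature.Claims.NS.Davlatov2020.Step3_TimeDerivL1` = §6 «1)» p.14,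
TeX l.716–719: «Если f ∈ C([0,T];H) ∩ L²(0,T;V′) тогда из (6.1) следует, что u′ ∈ C([0,T];(L¹(Ω))³)»
(«from (6.1) it follows that u′ ∈ C([0,T];L¹)»), typed at the grain the sentence uses: every field of
the weak class `L²(0,T;V) ∩ L^∞(0,T;H)` satisfying the mean identity (6.2) has an `L¹`-continuous time
derivative. WITNESS: `T = 1`, `f ≡ 0`, `u(t,x) = |t − ½|·c` with the constant vector `c = e₀ − e₁`
(`Σᵢ cᵢ = 0`), `u₀ = u(0)`. Then `f ∈ C([0,1];H)` trivially, `u` is in the weak class (energy `≤ ‖c‖²`,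
slices constant in `x`, hence in `H¹` with `‖u(t)‖_{H¹} ≤ ‖c‖_{H¹}`), (6.2) reads `0 = 0 + 0`; but an
`L¹`-continuous weak time derivative `w` would give, pairing with the smooth test field `φ ≡ c`,
`‖c‖²·|t − ½| = ∫_{½}^{t} g(τ) dτ` with `g(τ) = ∫⟪w(τ,x), c⟫dx` continuous on `[0,1]`, whence (FTC)
`t ↦ |t − ½|` would be differentiable at `t = ½`. The three spatial means that (6.1)/(6.2) control say
nothing about `u′` — [refuted-substantive] at the typed grain; the charitable NS-grain reading with the
`H²` datum of Theorem 3 (`Step3_TimeDerivL1_NS` ∧ `InVcapH2 u₀`, referee R#a) is an open regularity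
statement and stays an unfilled gap at the same sentence (load-bearing Theorem 3 p.5).

WHAT THIS IS NOT: not a claim about the Navier–Stokes problem itself; not a claim about any author
beyond the typed locator.
-/

set_option linter.dupNamespace false

open MeasureTheory Set Filter
open scoped ENNReal Topology RealInnerProductSpace

namespace Summit.NavierStokesRegularity.NavierStokesRegularity.Theorems.Davlatov2020

open Literature.Analysis Literature.Analysis.FunctionSpaces
open Literature.Analysis.FunctionSpaces.EuclideanSpace (complexify)
open Literature.Claims.NS.Davlatov2020

noncomputable section

/-- The constant direction `c = e₀ − e₁` of the witness (`Σᵢ cᵢ = 0`, `c ≠ 0`). -/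
def cvec : EuclideanSpace ℝ (Fin 3) := EuclideanSpace.single 0 1 - EuclideanSpace.single 1 1

/-- The Lipschitz, non-`C¹` time profile `h(t) = |t − ½|`. -/
def hprof (t : ℝ) : ℝ := |t - 1 / 2|

/-- The witness field `u(t,x) = |t − ½|·c` (constant in `x`). -/
def uW (t : ℝ) (_x : UnitAddTorus (Fin 3)) : EuclideanSpace ℝ (Fin 3) := hprof t • cvec

/-- `Σᵢ cᵢ = 0`. -/
theorem sum_cvec : ∑ i : Fin 3, cvec i = 0 := by
  simp [cvec]

/-- `c ≠ 0`. -/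
theorem cvec_ne_zero : cvec ≠ 0 := by
  intro h
  have h0 := congrArg (fun v : EuclideanSpace ℝ (Fin 3) => v 0) h
  simp [cvec] at h0

/-- `|h(t)| ≤ 1` on `(0,1)` (indeed `≤ ½`). -/
theorem abs_hprof_le_one {t : ℝ} (ht : t ∈ Ioo (0 : ℝ) 1) : |hprof t| ≤ 1 := by
  unfold hprof
  rw [abs_abs, abs_le]
  constructor <;> linarith [ht.1, ht.2]

/-- The sum of the spatial means of the witness vanishes at every time ((6.2) with `f ≡ 0`). -/
theorem meanSum_uW (t : ℝ) : meanSum (uW t) = 0 := by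
  unfold meanSum uW
  simp only [PiLp.smul_apply, smul_eq_mul, integral_const, measureReal_def, measure_univ,
    ENNReal.toReal_one, one_mul]
  rw [← Finset.mul_sum, sum_cvec, mul_zero]

/-- `meanSum` of the zero field is `0`. -/
theorem meanSum_zero : meanSum (fun _ : UnitAddTorus (Fin 3) => (0 : EuclideanSpace ℝ (Fin 3))) = 0 := by
  simp [meanSum]

/-- The zero force is in the class `C([0,T];H)` of Theorem 3. -/
theorem forceClass_zero (T : ℝ) : ForceClass T (fun _ _ => (0 : EuclideanSpace ℝ (Fin 3))) := by
  refine ⟨⟨fun t _ => MemLp.zero', fun t₀ _ => ?_⟩, fun t _ => ?_⟩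
  · simp only [sub_self, eLpNorm_zero]
    exact tendsto_const_nhds
  · intro θ _
    simp

/-- The complexified slices of the witness are real multiples of one constant field. -/
theorem complexify_uW (t : ℝ) :
    (complexify ∘ uW t) = hprof t • (fun _ : UnitAddTorus (Fin 3) => complexify cvec) := by
  funext x
  simp only [Function.comp_apply, uW, Pi.smul_apply]
  exact complexify.map_smul (hprof t) cvec

/-- The constant complex field `x ↦ complexify c` lies in every `H^s(𝕋³)` (smooth functions do). -/
theorem memSobolev_const (s : ℝ) : Torus.MemSobolev s (fun _ : UnitAddTorus (Fin 3) => complexify cvec) :=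
  Torus.IsSmooth.memSobolev_holds (Torus.isSmooth_const _) s

/-- The witness lies in the weak class `L^∞(0,1;L²) ∩ L²(0,1;H¹)` of Definition 2. -/
theorem inWeakClass_uW : InWeakClass 1 uW := by
  constructor
  · refine ⟨‖cvec‖ₑ ^ 2, ENNReal.pow_lt_top enorm_lt_top, ?_⟩
    refine (ae_restrict_iff' measurableSet_Ioo).2 (ae_of_all _ fun t ht => ?_)
    simp only [uW, lintegral_const, measure_univ, mul_one, enorm_smul]
    have h1 : ‖hprof t‖ₑ ≤ 1 := by
      rw [← ofReal_norm, Real.norm_eq_abs]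
      exact ENNReal.ofReal_le_one.2 (abs_hprof_le_one ht)
    calc (‖hprof t‖ₑ * ‖cvec‖ₑ) ^ 2 ≤ (1 * ‖cvec‖ₑ) ^ 2 := by gcongr
      _ = ‖cvec‖ₑ ^ 2 := by rw [one_mul]
  · constructor
    · refine (ae_restrict_iff' measurableSet_Ioo).2 (ae_of_all _ fun t _ => ?_)
      show Torus.MemSobolev 1 (complexify ∘ uW t)
      rw [complexify_uW]
      exact (memSobolev_const 1).real_smul (hprof t)
    · -- `∫₀¹ ‖u(t)‖²_{H¹} dt ≤ ‖c‖²_{H¹} < ∞`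
      set N : ℝ≥0∞ := Torus.eSobolevNorm 1 (fun _ : UnitAddTorus (Fin 3) => complexify cvec) with hN
      have hNfin : N < ∞ := (memSobolev_const 1).2
      have hslice : ∀ t ∈ Ioo (0 : ℝ) 1,
          Torus.eSobolevNorm 1 (complexify ∘ uW t) ^ 2 ≤ N ^ 2 := by
        intro t ht
        have hc : (complexify ∘ uW t) = ((hprof t : ℂ)) • (fun _ : UnitAddTorus (Fin 3) => complexify cvec) := by
          rw [complexify_uW]
          funext x
          simp [Complex.coe_smul]
        rw [hc, Torus.eSobolevNorm_const_smul]
        have h1 : ‖(hprof t : ℂ)‖ₑ ≤ 1 := by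
          rw [← ofReal_norm, Complex.norm_real, Real.norm_eq_abs]
          exact ENNReal.ofReal_le_one.2 (abs_hprof_le_one ht)
        calc (‖(hprof t : ℂ)‖ₑ * N) ^ 2 ≤ (1 * N) ^ 2 := by gcongr
          _ = N ^ 2 := by rw [one_mul]
      have hint : ∫⁻ t in Ioo (0 : ℝ) 1, Torus.eSobolevNorm 1 (complexify ∘ uW t) ^ 2 ≤ N ^ 2 := by
        calc ∫⁻ t in Ioo (0 : ℝ) 1, Torus.eSobolevNorm 1 (complexify ∘ uW t) ^ 2
            ≤ ∫⁻ _ in Ioo (0 : ℝ) 1, N ^ 2 := setLIntegral_mono measurable_const hslice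
          _ = N ^ 2 := by simp
      have hlt : ∫⁻ t in Ioo (0 : ℝ) 1, Torus.eSobolevNorm 1 (complexify ∘ uW t) ^ 2 < ∞ :=
        lt_of_le_of_lt hint (ENNReal.pow_lt_top hNfin)
      unfold Torus.eL2SobolevNorm
      exact ENNReal.rpow_lt_top_of_nonneg (by norm_num) hlt.ne

/-- (6.2) holds for the witness with `f ≡ 0` and `u₀ = u(0)`: `0 = 0 + ∫₀ᵗ 0`. -/
theorem identity62_uW : Identity62 1 (fun _ _ => (0 : EuclideanSpace ℝ (Fin 3))) (uW 0) uW := by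
  intro t _
  rw [meanSum_uW, meanSum_uW]
  simp [meanSum_zero]

/-- Pairing a weak time derivative with the constant test field `c`: the scalar
`g(τ) = ∫⟪w(τ,x), c⟫dx` is continuous on `[0,T]` when `w ∈ C([0,T];L¹)`. -/
theorem continuousOn_pairing {T : ℝ} {w : ℝ → UnitAddTorus (Fin 3) → EuclideanSpace ℝ (Fin 3)}
    (hw : FluidPDE.ContinuousInLpOn (Icc 0 T) 1 w) :
    ContinuousOn (fun τ => ∫ x, ⟪w τ x, cvec⟫) (Icc 0 T) := by
  intro t₀ ht₀
  have hint : ∀ t ∈ Icc 0 T, Integrable (w t) volume :=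
    fun t ht => memLp_one_iff_integrable.1 (hw.1 t ht)
  -- `‖w t − w t₀‖_{L¹} → 0` within `[0,T]`, as real numbers
  have hT : Tendsto (fun t => (eLpNorm (w t - w t₀) 1 volume).toReal) (𝓝[Icc 0 T] t₀) (𝓝 0) := by
    have h := (ENNReal.tendsto_toReal ENNReal.zero_ne_top).comp (hw.2 t₀ ht₀)
    rw [ENNReal.toReal_zero] at h
    exact h
  rw [ContinuousWithinAt, tendsto_iff_norm_sub_tendsto_zero]
  refine squeeze_zero_norm' ?_ (by simpa using hT.const_mul ‖cvec‖)
  filter_upwards [self_mem_nhdsWithin] with t ht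
  rw [norm_norm, ← integral_sub ((hint t ht).inner_const cvec) ((hint t₀ ht₀).inner_const cvec)]
  simp_rw [← inner_sub_left]
  have hsub : Integrable (w t - w t₀) volume := (hint t ht).sub (hint t₀ ht₀)
  calc ‖∫ x, ⟪w t x - w t₀ x, cvec⟫‖
      ≤ ∫ x, ‖⟪w t x - w t₀ x, cvec⟫‖ := norm_integral_le_integral_norm _
    _ ≤ ∫ x, ‖(w t - w t₀) x‖ * ‖cvec‖ := by
        refine integral_mono_of_nonneg (Eventually.of_forall fun x => norm_nonneg _) ?_
          (Eventually.of_forall fun x => ?_)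
        · exact hsub.norm.mul_const _
        · simp only [Pi.sub_apply, Real.norm_eq_abs]
          exact abs_real_inner_le_norm _ _
    _ = ‖cvec‖ * (eLpNorm (w t - w t₀) 1 volume).toReal := by
        rw [integral_mul_const, mul_comm, integral_norm_eq_lintegral_enorm hsub.aestronglyMeasurable,
          eLpNorm_one_eq_lintegral_enorm]

/-- **Refutes `Davlatov2020.Step3_TimeDerivL1` = §6 «1)» p.14, TeX l.716–719 [refuted-substantive]**:
the sentence «from (6.1) it follows that u′ ∈ C([0,T];(L¹(Ω))³)» is false for the class it is asserted
for — the weak class `L²(0,T;V) ∩ L^∞(0,T;H)` with `f ∈ C([0,T];H)` and the mean identity (6.2).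
Witness `T = 1`, `f ≡ 0`, `u(t,x) = |t − ½|·(e₀ − e₁)`, `u₀ = u(0)`: all three hypotheses hold and no
`w ∈ C([0,1];L¹)` is a weak time derivative of `u` (pair with `φ ≡ e₀ − e₁`; FTC at `t = ½` versus
`not_differentiableAt_abs_zero`). No cheap repair at this grain: (6.1)/(6.2) constrain three numbers
per time; the NS-grain reading with `u₀ ∈ V ∩ H²` (referee R#a) is a genuine regularity claim for all
weak solutions and is asserted, not proved (unfilled gap at the same sentence; load-bearing Theorem 3
p.5). [cite: Davlatov2016NSPeriodic, §6 1) p. 14 l.716–719] -/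
theorem not_Step3_TimeDerivL1 : ¬ Literature.Claims.NS.Davlatov2020.Step3_TimeDerivL1 := by
  intro h
  obtain ⟨w, hw, hid⟩ :=
    h 1 one_pos (fun _ _ => 0) (uW 0) uW (forceClass_zero 1) inWeakClass_uW identity62_uW
  -- the pairing `g(τ) = ∫⟪w τ, c⟫` and its primitive from `½`
  set g : ℝ → ℝ := fun τ => ∫ x, ⟪w τ x, cvec⟫ with hg
  have hgc : ContinuousOn g (Icc 0 1) := continuousOn_pairing hw
  have hhalf : (1 / 2 : ℝ) ∈ Ioo (0 : ℝ) 1 := by constructor <;> norm_num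
  have hgo : ContinuousOn g (Ioo 0 1) := hgc.mono Ioo_subset_Icc_self
  have hgat : ContinuousAt g (1 / 2) := hgo.continuousAt (Ioo_mem_nhds hhalf.1 hhalf.2)
  have hmeas : StronglyMeasurableAtFilter g (𝓝 (1 / 2 : ℝ)) volume :=
    ContinuousOn.stronglyMeasurableAtFilter isOpen_Ioo hgo _ hhalf
  have hG : HasDerivAt (fun t => ∫ τ in (1 / 2 : ℝ)..t, g τ) (g (1 / 2)) (1 / 2) :=
    intervalIntegral.integral_hasDerivAt_right IntervalIntegrable.refl hmeas hgat
  -- the weak-derivative identity against `φ ≡ c` pins the primitive to `‖c‖²·|t − ½|` on `[0,1]`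
  have hpin : ∀ t ∈ Icc (0 : ℝ) 1, ∫ τ in (1 / 2 : ℝ)..t, g τ = ⟪cvec, cvec⟫ * |t - 1 / 2| := by
    intro t ht
    have hs : (1 / 2 : ℝ) ∈ Icc (0 : ℝ) 1 := ⟨hhalf.1.le, hhalf.2.le⟩
    have key := hid (1 / 2) hs t ht (fun _ => cvec) (Torus.isSmooth_const _)
    rw [← key]
    simp only [uW, hprof, sub_self, abs_zero, zero_smul, sub_zero, real_inner_smul_left,
      integral_const, smul_eq_mul, measureReal_def, measure_univ, ENNReal.toReal_one, one_mul]
    ring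
  set K : ℝ := ⟪cvec, cvec⟫ with hK
  have hKne : K ≠ 0 := inner_self_ne_zero.2 cvec_ne_zero
  -- hence `t ↦ K·|t − ½|` has a derivative at `½`, and so has `|·|` at `0`
  have hev : (fun t => K * |t - 1 / 2|) =ᶠ[𝓝 (1 / 2 : ℝ)] fun t => ∫ τ in (1 / 2 : ℝ)..t, g τ := by
    filter_upwards [Ioo_mem_nhds hhalf.1 hhalf.2] with t ht
    exact (hpin t (Ioo_subset_Icc_self ht)).symm
  have hD : HasDerivAt (fun t => K * |t - 1 / 2|) (g (1 / 2)) (1 / 2) := hG.congr_of_eventuallyEq hev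
  have hpt : (0 : ℝ) + 1 / 2 = 1 / 2 := by norm_num
  have hD' : HasDerivAt (fun t => K * |t - 1 / 2|) (g (1 / 2)) ((0 : ℝ) + 1 / 2) := by
    rw [hpt]; exact hD
  have hD0 : HasDerivAt (fun y : ℝ => K * |y + 1 / 2 - 1 / 2|) (g (1 / 2)) 0 :=
    HasDerivAt.comp_add_const 0 (1 / 2) hD'
  have habs : DifferentiableAt ℝ (abs : ℝ → ℝ) 0 := by
    have h2 := (hD0.const_mul K⁻¹).differentiableAt
    have heq : (fun y : ℝ => K⁻¹ * (K * |y + 1 / 2 - 1 / 2|)) = (abs : ℝ → ℝ) := by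
      funext y
      rw [add_sub_cancel_right, ← mul_assoc, inv_mul_cancel₀ hKne, one_mul]
    rwa [heq] at h2
  exact not_differentiableAt_abs_zero habs

end

end Summit.NavierStokesRegularity.NavierStokesRegularity.Theorems.Davlatov2020
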